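import Summits.QuantumFields.GaugeBoot.BootstrapInvariantCertificates
import HarnessLib

/-!
# Imposing a symmetry on the truncated bootstrap = bounding the orbit-averaged objective (gauge-boot, L1/L4 supplement)

HONEST FRAMING (cell `pub-gaugeboot`, page 1 of every file): the venture produces certified bounds
on lattice expectations at stated coupling, gauge group, dimension and torus size; NOT a mass gap,
NOT a continuum limit, NOT a string tension; NOT Yang–Mills-summit-bearing (barriers
`FixedCouplingUltralocality`, `PerturbativeInvisibility`). Structural; it certifies no number.

## Content

`BootstrapSymmetryReduction`: for an INVARIANT objective the symmetry-reduced level-`n` SDP is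
lossless. For a NON-invariant objective `P` (e.g. a single plaquette `u_P(x)`), what does imposing the
symmetry compute? Exactly the plain level-`n` bounds of the ORBIT AVERAGE `P̄ = (1/|Γ|) Σ_γ P ∘ R_γ`
(e.g. the lattice-averaged plaquette):

* `apply_avgObs_of_invariantOn` — a functional invariant on the test functions takes the same value
  on `P ∈ V_n` and on its orbit average;
* ★★★ `symLevelValues_eq_levelValues_avgObs_suN` — `SU(N)` torus, any `β`, level `n`, `P` a
  level-`n` test function, the orientation-preserving lattice symmetries: the feasible values of `P`
  in the symmetry-reduced SDP are the plain level-`n` feasible values of `P̄`. Consequently imposing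
  the symmetry IMPROVES the level-`n` bound on `P` exactly when the plain bound on `P̄` is better
  than the plain bound on `P` (`sSup_symLevelValues_le_suN`: it is never worse).

References: K. Gatermann, P. A. Parrilo, J. Pure Appl. Algebra 192 (2004) 95, §3; V. Kazakov,
Z. Zheng, arXiv:2203.11360 §3.2. Folklore.
-/

noncomputable section

open MeasureTheory Filter Topology NormedSpace
open Literature.MathematicalPhysics.QuantumFieldTheory (LatticeRep Site Edge GaugeConfig wilsonAction
  wilsonMeasure)
open Literature.MathematicalPhysics.QuantumLattice

namespace Summit.QuantumFields.GaugeBoot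

section General

variable {ι : Type*} {G : Type*} [TopologicalSpace G] {Γ : Type*} [Fintype Γ]

/-- **An invariant functional does not distinguish a test function from its orbit average.** -/
theorem apply_avgObs_of_invariantOn [Nonempty Γ] (R : Γ → C(ι → G, ι → G)) {V : Set C(ι → G, ℝ)}
    {φ : C(ι → G, ℝ) →ₗ[ℝ] ℝ} (hφ : ∀ γ, ∀ v ∈ V, φ (v.comp (R γ)) = φ v) {P : C(ι → G, ℝ)}
    (hP : P ∈ V) : φ (avgObs R P) = φ P := by
  unfold avgObs
  rw [map_smul, map_sum]
  simp only [fun γ => hφ γ P hP, Finset.sum_const, Finset.card_univ, smul_eq_mul, nsmul_eq_mul]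
  rw [← mul_assoc, inv_mul_cancel₀ (Nat.cast_ne_zero.2 Fintype.card_ne_zero), one_mul]

end General

section SuN

variable {d L : ℕ} [NeZero L] (N : ℕ) (β : ℝ) (n : ℕ)

/-- ★★★ **Imposing the lattice symmetries = bounding the orbit-averaged objective.** `SU(N)`, torus
`(ℤ/L)^d`, any real `β`, level `n`, `P` a level-`n` test function (e.g. a single plaquette,
`n ≥ 4`): the feasible values of `P` in the level-`n` SDP with translation and axis-permutation
invariance imposed coincide with the plain level-`n` feasible values of the orbit average
`P̄ = (1/|Γ|) Σ_p P ∘ (U ↦ U ∘ e_p)` (e.g. the lattice-averaged plaquette).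
[cite: GatermannParrilo2004, Thm 3.3] -/
theorem symLevelValues_eq_levelValues_avgObs_suN
    {P : C(GaugeConfig d L (Matrix.specialUnitaryGroup (Fin N) ℂ), ℝ)}
    (hP : P ∈ wordTruncation (ι := Edge d L) (fundamentalLatticeRep N) n) :
    symLevelValuesSuN (d := d) (L := L) N β n
        (Set.range fun p : Equiv.Perm (Fin d) × Site d L =>
          relabelCM (G := Matrix.specialUnitaryGroup (Fin N) ℂ) (latticeRelabel p)) P =
      levelValuesSuN (d := d) (L := L) N β n
        (avgObs (fun p : Equiv.Perm (Fin d) × Site d L =>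
          relabelCM (G := Matrix.specialUnitaryGroup (Fin N) ℂ) (latticeRelabel p)) P) := by
  set R : Equiv.Perm (Fin d) × Site d L →
      C(GaugeConfig d L (Matrix.specialUnitaryGroup (Fin N) ℂ), GaugeConfig d L (Matrix.specialUnitaryGroup (Fin N) ℂ)) :=
    fun p => relabelCM (G := Matrix.specialUnitaryGroup (Fin N) ℂ) (latticeRelabel p) with hRdef
  have hinv : ∀ p, (avgObs R P).comp (R p) = avgObs R P :=
    fun p => avgObs_comp_eq R (relabelCM_latticeRelabel_closed N) P p
  ext t
  constructor
  · rintro ⟨φ, hφ, hφinv, rfl⟩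
    refine ⟨φ, hφ, ?_⟩
    exact apply_avgObs_of_invariantOn R (fun p v hv => hφinv (R p) ⟨p, rfl⟩ v hv) hP
  · intro ht
    rw [← latticeSymLevelValues_eq_levelValues_suN N β n hinv] at ht
    obtain ⟨φ, hφ, hφinv, hφt⟩ := ht
    refine ⟨φ, hφ, hφinv, ?_⟩
    rw [← hφt]
    exact (apply_avgObs_of_invariantOn R (fun p v hv => hφinv (R p) ⟨p, rfl⟩ v hv) hP).symm

/-- ★★ **Imposing the symmetry never weakens and may improve the bound on a non-invariant
objective**: `sup sym(P) = sup plain(P̄) ≤ sup plain(P)` (the first equality is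
`symLevelValues_eq_levelValues_avgObs_suN`, the inequality `symLevelValues_subset_levelValues`;
stated for bounded-above value sets). [folklore] -/
theorem sSup_symLevelValues_le_suN
    {P : C(GaugeConfig d L (Matrix.specialUnitaryGroup (Fin N) ℂ), ℝ)}
    (hbdd : BddAbove (levelValuesSuN (d := d) (L := L) N β n P))
    (hne : (symLevelValuesSuN (d := d) (L := L) N β n
        (Set.range fun p : Equiv.Perm (Fin d) × Site d L =>
          relabelCM (G := Matrix.specialUnitaryGroup (Fin N) ℂ) (latticeRelabel p)) P).Nonempty) :
    sSup (symLevelValuesSuN (d := d) (L := L) N β n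
        (Set.range fun p : Equiv.Perm (Fin d) × Site d L =>
          relabelCM (G := Matrix.specialUnitaryGroup (Fin N) ℂ) (latticeRelabel p)) P) ≤
      sSup (levelValuesSuN (d := d) (L := L) N β n P) :=
  csSup_le_csSup hbdd hne (symLevelValues_subset_levelValues N β n _ P)

end SuN

end Summit.QuantumFields.GaugeBoot

end
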